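import Literature.NumberTheory.EllipticCurves.Selmer
import Literature.NumberTheory.EllipticCurves.KummerMap
import Literature.NumberTheory.EllipticCurves.SelmerProofs
import Literature.NumberTheory.EllipticCurves.VariableChangePointsMap
import Literature.NumberTheory.Automorphic.GaloisActionPlaces
import Mathlib.NumberTheory.NumberField.Completion.InfinitePlace
import Mathlib.Analysis.Complex.Polynomial.Basic
import HarnessLib

/-!
# The action of `Aut(K/k)` on `H¹(K, E[n])`, strict local conditions, Galois stability of `Sel`

Infrastructure for Kolyvagin's descent (B. H. Gross, *Kolyvagin's work on modular elliptic curves*,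
LMS Lecture Note Ser. 153 (1991), §§5–10, where `Gal(K/ℚ) = ⟨1, τ⟩` acts on `H¹(K, E_p)` and on
`Sel(E/K)_p`, (5.1), and classes are tested locally in `H¹(K_λ, E_p)`, Props. 8.2, 9.6), built on
the tree's continuous Galois cohomology of Weierstrass curves (`GaloisAction`, `Sha`, `Selmer`,
`KummerMap`, `SelmerProofs`). Everything in this file is **proved**; there are no named facts.

## Contents

* `Literature.NumberTheory.EllipticCurves.conjAct W σ n : H¹(K, E[n]) →+ H¹(K, E[n])` — for a
  Weierstrass curve `E = W` over a field `k`, a field extension `K/k` and `σ ∈ Aut(K/k)`: lift `σ`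
  to a ring automorphism `τ` of `K̄ = AlgebraicClosure K` (`IsLiftOfAut`, `liftAut` via Mathlib
  `IsAlgClosure.equivOfEquiv`), conjugate `Γ_K` by it (`IsLiftOfAut.conjGalCMH`, continuity for
  the Krull topology proved), move `E[n] ⊆ E(K̄)` by it (`IsLiftOfAut.torsionMap`, through Mathlib
  `Affine.Point.map` on `W⁄K̄ = (W⁄K)⁄K̄`), and take Mathlib's `ContinuousCohomology.map` along the
  compatible pair: `[f] ↦ [g ↦ τ f(τ⁻¹ g τ)]`. The result does not depend on the lift
  (`IsLiftOfAut.conjH1_eq`: two lifts differ by an element of `Γ_K`, and inner automorphisms act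
  trivially on `H¹` — the tree's `map_conj_one_eq_id`, Serre, *Corps locaux*, VII.§5, Prop. 3),
  is multiplicative (`conjAct_mul`), trivial for `σ = 1` (`conjAct_one`), so an involution `σ`
  acts as an involution (`conjAct_conjAct_of_mul_self`; e.g. complex conjugation of an imaginary
  quadratic field, giving the eigenspace decomposition `H¹(K, E_p) = H¹(K, E_p)⁺ ⊕ H¹(K, E_p)⁻`
  of Gross 1991, (5.1), for odd `p`).
* `WeierstrassCurve.torsionLocalKer W E n = ker (H¹(K, E[n]) → H¹(E, E(K̄_E)[n]))` at a `K`-field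
  `E` (a completion): the strict local condition "`s_λ = 0` in `H¹(K_λ, E_p)`" of Gross 1991,
  Props. 8.2, 9.6, and "`c_λ = 0`" of McCallum 1991, §3 (3); the finite-level analogue of the tree's
  `selmerLocalKerPrimaryTorsion` (`BSDSelmer`). It is contained in the Selmer local kernel
  `selmerLocalKer W E n = ker (H¹(K, E[n]) → H¹(E, E))` (`torsionLocalKer_le_selmerLocalKer`).
* **Transport** (`conjAct_mem_selmerLocalKer_iff`): for `E = W/ℚ`, `σ ∈ Aut(K/ℚ)` and a
  `σ`-semilinear ring isomorphism `θ : E ≃+* E'` of `K`-fields (`θ ∘ ι_E = ι_{E'} ∘ σ`; the case in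
  point is the Galois transport of completions `K_v ≃ K_{σ v}`), `σ_* s` satisfies the Selmer
  local condition at `E'` iff `s` satisfies it at `E`. Proof: lift `θ` to `Θ : K̄_E ≃+* K̄_{E'}`
  (`IsLiftOfRingEquiv`); by the independence of the embedding `K̄ → K̄_{E'}` (tree
  `selmerLocalKer_eq_of_algHom_holds`) one may use `ι' = Θ ∘ ι_E ∘ τ⁻¹`, for which the two
  compatible pairs `Γ_{E'} ⇉ Γ_K`, `E[n] ⇉ E(K̄_{E'})` coincide on the nose
  (`conjGalCMH_comp_resGalOfEmb_embOfLifts`, `pointsMapOfEmb_embOfLifts_comp_torsionMap`), and the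
  map `H¹(E, E(K̄_E)) → H¹(E', E(K̄_{E'}))` induced by `Θ` is injective
  (`IsLiftOfRingEquiv.map_injective`, left inverse induced by `Θ⁻¹`).
* `WeierstrassCurve.selmerLocalKer_eq_top_of_isAlgClosed`: at an algebraically closed `K`-field
  (a complex place) the local condition is empty, `Γ_E` being trivial (Gross 1991, proof of
  Prop. 6.2 (1): "If `v = ∞`, `K_v = ℂ` is algebraically closed and the Galois cohomology of `E` is
  trivial").
* **Stability** (`conjAct_mem_selmerGroup`): for a number field `K` all of whose infinite places
  are complex and `E = W/ℚ`, the Selmer group `Sel^(n)(E/K) ⊆ H¹(K, E[n])` is stable under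
  `Aut(K/ℚ)` — the `Gal(K/ℚ)`-module structure of `Sel(E/K)_p` ("`Sel(E/K)_p^±`") used throughout
  Gross 1991, §§5–10. The isomorphisms `K_v ≃+* K_{σ v}` over `σ` are the tree's
  `Literature.NumberTheory.Automorphic.galAdicCompletionEquiv` (`Automorphic/GaloisActionPlaces`,
  Cassels–Fröhlich, Ch. VII (Tate), §1.1: "`σ` induces by continuity an isomorphism
  `σ_w : L_w → L_{σ w}`").

## Design notes

* Base field generality: the action is built for any `W` over `k` and `K/k` (`k : Type v`,
  `K : Type u`); the transport and stability statements are for `k = ℚ`, where the double base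
  change `(W⁄K)⁄F = W⁄F` holds for every characteristic-`0` field `F` by `Subsingleton (ℚ →+* F)`
  (`baseChange_baseChange_eq`), points being moved across it by the tree's
  `WeierstrassCurve.Affine.Point.congrEquiv` (`VariableChangePointsMap`). For `F = K̄` the two
  curves are even definitionally equal, which is what makes `IsLiftOfAut.pointsMap` typecheck.
* Lifts are kept as hypotheses `IsLiftOfAut σ τ` / `IsLiftOfRingEquiv θ Θ` on arbitrary ring
  isomorphisms, so that inverses and composites of lifts are again lifts definitionally; the
  chosen lifts `liftAut σ`, `ringEquivLift θ` only enter `conjAct` and the final statements.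
* `Field.absoluteGaloisGroup` is a type synonym; elementwise computations go through
  `show K̄ ≃ₐ[K] K̄ from g`, as in `Sha.lean`.
* New declarations in Mathlib's namespace `WeierstrassCurve` are deliberate dot-notation
  extensions (`torsionLocalKer`, `selmerLocalKer_eq_top_of_…`, and the proof-irrelevance helper
  `Affine.Point.some_eq_some_of_eq`), in the style of `Selmer.lean`.
* Not here: anything specific to Heegner points or Kolyvagin primes (file
  `HeegnerPointsKolyvaginEulerSystem`), and the real places (the stability statement assumes all
  infinite places complex, which covers imaginary quadratic `K`).

## References

* B. H. Gross, *Kolyvagin's work on modular elliptic curves*, in *`L`-functions and arithmetic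
  (Durham, 1989)*, LMS Lecture Note Ser. 153 (1991), 235–256: §5 (5.1), §6 (proof of Prop. 6.2
  (1)), Props. 8.2, 9.6 (held: `book:editornd-l-functions-arithmetic`, PDF pp. 219–229).
  [GrossLMS1991]
* W. G. McCallum, *Kolyvagin's work on Shafarevich–Tate groups*, same volume, 295–316, §3
  (PDF pp. 279–280). [McCallumLMS1991]
* J.-P. Serre, *Local Fields*, GTM 67 (1979), VII.§5, Prop. 3 (inner automorphisms act trivially
  on cohomology); *Galois Cohomology* (1997), II.§1.1. [SerreLocalFields1979]
  [SerreGaloisCohomology1997]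
* J. W. S. Cassels, A. Fröhlich (eds.), *Algebraic Number Theory* (1967), Ch. VII (J. Tate),
  §1.1 (action of the Galois group on primes and completions). [CasselsFrohlichANT1967]
* J. H. Silverman, *The Arithmetic of Elliptic Curves*, 2nd ed. (2009), X.§4 (Selmer groups).
  [SilvermanAEC2009]
-/

noncomputable section

open scoped Classical
open WeierstrassCurve

universe u v

namespace Literature.NumberTheory.EllipticCurves
section LiftAut

variable {k : Type v} {K : Type u} [Field k] [Field K] [Algebra k K]

/-- A ring automorphism `τ` of `K̄ = AlgebraicClosure K` **lifts** `σ ∈ Aut(K/k)` if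
`τ ∘ ι = ι ∘ σ` for the structure map `ι : K → K̄` (Gross 1991, §3: "`τ` is complex conjugation,
which lifts to an involution of `K_n`"; here lifted all the way to `K̄`). [folklore] -/
def IsLiftOfAut (σ : K ≃ₐ[k] K) (τ : AlgebraicClosure K ≃+* AlgebraicClosure K) : Prop :=
  ∀ x : K, τ (algebraMap K (AlgebraicClosure K) x) = algebraMap K (AlgebraicClosure K) (σ x)

/-- A chosen lift of `σ ∈ Aut(K/k)` to a ring automorphism of `K̄` (Mathlib
`IsAlgClosure.equivOfEquiv`: algebraic closures of isomorphic fields are isomorphic over the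
isomorphism). [folklore] -/
def liftAut (σ : K ≃ₐ[k] K) : AlgebraicClosure K ≃+* AlgebraicClosure K :=
  IsAlgClosure.equivOfEquiv (R := K) (S := K) (AlgebraicClosure K) (AlgebraicClosure K)
    (σ : K ≃+* K)

/-- The chosen lift `liftAut σ` lifts `σ` (Mathlib `IsAlgClosure.equivOfEquiv_algebraMap`).
[folklore] -/
theorem isLiftOfAut_liftAut (σ : K ≃ₐ[k] K) : IsLiftOfAut σ (liftAut σ) := fun x ↦ by
  unfold liftAut
  exact IsAlgClosure.equivOfEquiv_algebraMap (R := K) (S := K) (AlgebraicClosure K)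
    (AlgebraicClosure K) (σ : K ≃+* K) x

variable {σ : K ≃ₐ[k] K} {τ : AlgebraicClosure K ≃+* AlgebraicClosure K}

/-- The inverse of a lift of `σ` restricts to `σ⁻¹` on `K`. [folklore] -/
theorem IsLiftOfAut.symm_apply (hτ : IsLiftOfAut σ τ) (x : K) :
    τ.symm (algebraMap K (AlgebraicClosure K) x) =
      algebraMap K (AlgebraicClosure K) (σ.symm x) := by
  apply τ.injective
  rw [RingEquiv.apply_symm_apply, hτ, AlgEquiv.apply_symm_apply]

/-- A lift of `σ ∈ Aut(K/k)` is `k`-linear. [folklore] -/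
theorem IsLiftOfAut.map_algebraMap (hτ : IsLiftOfAut σ τ) (x : k) :
    τ (algebraMap k (AlgebraicClosure K) x) = algebraMap k (AlgebraicClosure K) x := by
  rw [IsScalarTower.algebraMap_apply k K (AlgebraicClosure K), hτ, AlgEquiv.commutes]

/-- A lift of `σ ∈ Aut(K/k)`, as a `k`-algebra automorphism of `K̄`. [folklore] -/
def IsLiftOfAut.algEquiv (hτ : IsLiftOfAut σ τ) : AlgebraicClosure K ≃ₐ[k] AlgebraicClosure K :=
  { τ with commutes' := hτ.map_algebraMap }

/-- Unfolding `IsLiftOfAut.algEquiv`. [folklore] -/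
@[simp] theorem IsLiftOfAut.algEquiv_apply (hτ : IsLiftOfAut σ τ) (x : AlgebraicClosure K) :
    hτ.algEquiv x = τ x := rfl

local notation "Kbar" => AlgebraicClosure K

/-- Conjugation of `Gal(K̄/K)` by a lift `τ` of `σ`: `g ↦ τ⁻¹ g τ`, which is again `K`-linear
(`τ⁻¹ g τ` fixes `K` because `τ|_K = σ` and `g` fixes `K`). Serre, *Galois Cohomology*, I.§2.4
(compatible pairs). [folklore] -/
def IsLiftOfAut.conjGal (hτ : IsLiftOfAut σ τ) (g : Kbar ≃ₐ[K] Kbar) : Kbar ≃ₐ[K] Kbar :=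
  { τ.trans (g.toRingEquiv.trans τ.symm) with
    commutes' := fun x ↦ by
      change τ.symm (g (τ (algebraMap K _ x))) = _
      rw [hτ, AlgEquiv.commutes, hτ.symm_apply, AlgEquiv.symm_apply_apply] }

/-- Unfolding `IsLiftOfAut.conjGal`: `(τ⁻¹ g τ) x = τ⁻¹ (g (τ x))`. [folklore] -/
theorem IsLiftOfAut.conjGal_apply (hτ : IsLiftOfAut σ τ) (g : Kbar ≃ₐ[K] Kbar) (x : Kbar) :
    hτ.conjGal g x = τ.symm (g (τ x)) := rfl

/-- `conjGal` as a group homomorphism `Γ_K → Γ_K`. [folklore] -/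
def IsLiftOfAut.conjGalHom (hτ : IsLiftOfAut σ τ) :
    Field.absoluteGaloisGroup K →* Field.absoluteGaloisGroup K where
  toFun g := hτ.conjGal g
  map_one' := by
    apply AlgEquiv.ext
    intro x
    change τ.symm (τ x) = x
    exact τ.symm_apply_apply x
  map_mul' g h := by
    apply AlgEquiv.ext
    intro x
    change τ.symm ((show Kbar ≃ₐ[K] Kbar from g) ((show Kbar ≃ₐ[K] Kbar from h) (τ x))) =
      τ.symm ((show Kbar ≃ₐ[K] Kbar from g) (τ (τ.symm ((show Kbar ≃ₐ[K] Kbar from h) (τ x)))))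
    rw [RingEquiv.apply_symm_apply]

/-- Unfolding `IsLiftOfAut.conjGalHom`. [folklore] -/
theorem IsLiftOfAut.conjGalHom_apply (hτ : IsLiftOfAut σ τ) (g : Field.absoluteGaloisGroup K)
    (x : Kbar) :
    (show Kbar ≃ₐ[K] Kbar from hτ.conjGalHom g) x =
      τ.symm ((show Kbar ≃ₐ[K] Kbar from g) (τ x)) := rfl

/-- Continuity of `conjGalHom` for the Krull topology: the preimage of `Gal(K̄/L)`, `L/K` finite,
contains `Gal(K̄/K(τ b₁, …, τ bₙ))` for a `K`-basis `bᵢ` of `L` (cf. the tree's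
`continuous_resGalAuxOfEmb`). Serre, *Galois Cohomology*, II.§1.1. [folklore] -/
theorem IsLiftOfAut.continuous_conjGalHom (hτ : IsLiftOfAut σ τ) : Continuous hτ.conjGalHom := by
  apply continuous_of_continuousAt_one _ (continuousAt_def.mpr _)
  intro N hN
  rw [map_one] at hN
  obtain ⟨L', hfd, hO⟩ := (krullTopology_mem_nhds_one_iff K Kbar N).mp hN
  refine (krullTopology_mem_nhds_one_iff K Kbar _).mpr ?_
  let b := Module.finBasis K L'
  let S : Set Kbar := Set.range fun i => τ (b i)
  refine ⟨IntermediateField.adjoin K S, ?_, ?_⟩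
  · exact IntermediateField.finiteDimensional_adjoin fun x _ => Algebra.IsIntegral.isIntegral x
  · intro g hg
    apply hO
    simp only [SetLike.mem_coe, IntermediateField.mem_fixingSubgroup_iff] at hg ⊢
    intro y hy
    change τ.symm ((show Kbar ≃ₐ[K] Kbar from g) (τ y)) = y
    have key : ∀ i, (show Kbar ≃ₐ[K] Kbar from g) (τ (b i)) = τ (b i) := fun i =>
      hg _ (IntermediateField.subset_adjoin K S ⟨i, rfl⟩)
    -- `y ↦ τ⁻¹ g τ y` and `id` are `K`-linear maps `L' → K̄` agreeing on the basis
    have hlin := b.ext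
      (f₁ := (hτ.conjGal (show Kbar ≃ₐ[K] Kbar from g)).toLinearMap ∘ₗ L'.val.toLinearMap)
      (f₂ := L'.val.toLinearMap) (fun i => by
        simp only [LinearMap.coe_comp, Function.comp_apply, AlgEquiv.toLinearMap_apply,
          hτ.conjGal_apply]
        change τ.symm (((show Kbar ≃ₐ[K] Kbar from g)) (τ (b i))) = (b i : Kbar)
        rw [key, RingEquiv.symm_apply_apply])
    exact congr($hlin ⟨y, hy⟩)

/-- `conjGalHom` as a continuous monoid homomorphism `Γ_K →ₜ* Γ_K`. [folklore] -/
def IsLiftOfAut.conjGalCMH (hτ : IsLiftOfAut σ τ) :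
    Field.absoluteGaloisGroup K →ₜ* Field.absoluteGaloisGroup K where
  toMonoidHom := hτ.conjGalHom
  continuous_toFun := hτ.continuous_conjGalHom



/-- Two affine points with equal coordinates are equal (proof-irrelevance helper; a deliberate
declaration in Mathlib's `WeierstrassCurve.Affine.Point` namespace). [folklore] -/
theorem _root_.WeierstrassCurve.Affine.Point.some_eq_some_of_eq {F : Type*} [Field F]
    {V : WeierstrassCurve.Affine F} {x y x' y' : F} (hx : x = x') (hy : y = y')
    {h : V.Nonsingular x y} {h' : V.Nonsingular x' y'} :
    WeierstrassCurve.Affine.Point.some x y h = .some x' y' h' := by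
  subst hx hy
  rfl

/-! ### Action of a lift on `E(K̄)` and on `H¹(K, E[n])` for `E` defined over `k` -/

variable (W : WeierstrassCurve k)

/-- The action `P ↦ τ P` of a lift `τ` of `σ ∈ Aut(K/k)` on the geometric points `E(K̄)` of
`E = W/k` viewed over `K`: Mathlib `Affine.Point.map` along the `k`-algebra automorphism `τ` of
`K̄`, on `W⁄K̄ = (W⁄K)⁄K̄` (definitionally equal curves). Gross 1991, §5 ("complex conjugation `τ`
acts on … the point `y_n` in `E(K_n)`"). [folklore] -/
def IsLiftOfAut.pointsMap (hτ : IsLiftOfAut σ τ) :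
    geomPoints (W.baseChange K) →+ geomPoints (W.baseChange K) :=
  WeierstrassCurve.Affine.Point.map (W' := W) (hτ.algEquiv : Kbar →ₐ[k] Kbar)

/-- Compatibility of the pair `(conjGalCMH, pointsMap)`: `τ (τ⁻¹ g τ • P) = g • τ P`.
Serre, *Galois Cohomology*, I.§2.4. [folklore] -/
theorem IsLiftOfAut.pointsMap_smul (hτ : IsLiftOfAut σ τ) (g : Field.absoluteGaloisGroup K)
    (P : geomPoints (W.baseChange K)) :
    hτ.pointsMap W (hτ.conjGalCMH g • P) = g • hτ.pointsMap W P := by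
  change ((W.baseChange K).baseChange Kbar).toAffine.Point at P
  rcases P with _ | ⟨x, y, h⟩
  · rfl
  · change WeierstrassCurve.Affine.Point.map (W' := W) (hτ.algEquiv : Kbar →ₐ[k] Kbar)
        (WeierstrassCurve.Affine.Point.map (W' := W.baseChange K)
          ((show Kbar ≃ₐ[K] Kbar from hτ.conjGalCMH g : Kbar ≃ₐ[K] Kbar) : Kbar →ₐ[K] Kbar)
          (.some x y h)) =
      WeierstrassCurve.Affine.Point.map (W' := W.baseChange K)
        ((show Kbar ≃ₐ[K] Kbar from g : Kbar ≃ₐ[K] Kbar) : Kbar →ₐ[K] Kbar)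
        (WeierstrassCurve.Affine.Point.map (W' := W) (hτ.algEquiv : Kbar →ₐ[k] Kbar) (.some x y h))
    exact Affine.Point.some_eq_some_of_eq (τ.apply_symm_apply _) (τ.apply_symm_apply _)

/-- The action of a lift on the `n`-torsion `E[n] ⊆ E(K̄)` (a homomorphism preserves
`n`-torsion). [folklore] -/
def IsLiftOfAut.torsionMap (hτ : IsLiftOfAut σ τ) (n : ℤ) :
    geomTorsion (W.baseChange K) n →+ geomTorsion (W.baseChange K) n :=
  ((hτ.pointsMap W).comp (geomTorsion (W.baseChange K) n).subtype).codRestrict _ fun P ↦ by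
    simp only [AddMonoidHom.coe_comp, AddSubgroup.coe_subtype, Function.comp_apply]
    rw [mem_geomTorsion_iff, ← map_zsmul, (mem_geomTorsion_iff _ n _).mp P.2, map_zero]

/-- Unfolding `IsLiftOfAut.torsionMap` on underlying points. [folklore] -/
@[simp] theorem IsLiftOfAut.coe_torsionMap (hτ : IsLiftOfAut σ τ) (n : ℤ)
    (P : geomTorsion (W.baseChange K) n) :
    (hτ.torsionMap W n P : geomPoints (W.baseChange K)) = hτ.pointsMap W P := rfl

/-- Compatibility of the pair `(conjGalCMH, torsionMap)` on `E[n]` (from `pointsMap_smul`).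
[folklore] -/
theorem IsLiftOfAut.torsionMap_smul (hτ : IsLiftOfAut σ τ) (n : ℤ)
    (g : Field.absoluteGaloisGroup K) (P : geomTorsion (W.baseChange K) n) :
    hτ.torsionMap W n (hτ.conjGalCMH g • P) = g • hτ.torsionMap W n P :=
  Subtype.ext (hτ.pointsMap_smul W g P)

/-- The automorphism of `H¹(K, E[n])` induced by the lift `τ` of `σ ∈ Aut(K/k)`:
`[f] ↦ [g ↦ τ f(τ⁻¹ g τ)]` (Mathlib `ContinuousCohomology.map` along the compatible pair
`(conjGalCMH, torsionMap)`). Gross 1991, §5 (5.1) (the action of `Gal(K/ℚ) = ⟨1, τ⟩` on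
`H¹(K, E_p)`); Serre, *Galois Cohomology*, I.§2.4. [folklore] -/
def IsLiftOfAut.conjH1 (hτ : IsLiftOfAut σ τ) (n : ℤ) :
    galH1Torsion (W.baseChange K) n →+ galH1Torsion (W.baseChange K) n :=
  (ContinuousCohomology.map hτ.conjGalCMH
    (resHomOfEquivariant hτ.conjGalCMH (hτ.torsionMap W n)
      (hτ.torsionMap_smul W n)) 1).hom.toLinearMap.toAddMonoidHom


/-! ### Independence of the lift, multiplicativity, identity -/

section Generic

open CategoryTheory ContRepresentation TopRep

variable {G : Type u} [Group G] [TopologicalSpace G] [IsTopologicalGroup G]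
variable {M : Type u} [AddCommGroup M] [DistribMulAction G M] [TopologicalSpace M]
  [DiscreteTopology M]
variable {H : Type u} [Group H] [TopologicalSpace H] [IsTopologicalGroup H]
variable {N : Type u} [AddCommGroup N] [DistribMulAction H N] [TopologicalSpace N]
  [DiscreteTopology N]
variable {L : Type u} [Group L] [TopologicalSpace L] [IsTopologicalGroup L]
variable {Q : Type u} [AddCommGroup Q] [DistribMulAction L Q] [TopologicalSpace Q]
  [DiscreteTopology Q]

/-- Precomposing a compatible pair `(φ, ψ)` with the inner pair `(g ↦ γ⁻¹ g γ, m ↦ γ • m)` of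
`γ ∈ G` does not change the induced map `H¹(G, M) → H¹(H, N)` (inner automorphisms act trivially
on `H¹`, `map_conj_one_eq_id`). Congruence form. Serre, *Corps locaux*, VII.§5, Prop. 3.
[folklore] -/
theorem map_one_eq_of_conj_comp (φ : H →ₜ* G) (ψ : M →+ N)
    (h : ∀ (x : H) (m : M), ψ (φ x • m) = x • ψ m) (γ : G) {φ' : H →ₜ* G} {ψ' : M →+ N}
    (h' : ∀ (x : H) (m : M), ψ' (φ' x • m) = x • ψ' m)
    (hφ : φ' = (conjCMH γ).comp φ) (hψ : ψ' = ψ.comp (DistribSMul.toAddMonoidHom M γ)) :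
    ContinuousCohomology.map φ' (resHomOfEquivariant φ' ψ' h') 1 =
      ContinuousCohomology.map φ (resHomOfEquivariant φ ψ h) 1 := by
  subst hφ hψ
  have e : resHomOfEquivariant ((conjCMH γ).comp φ) (ψ.comp (DistribSMul.toAddMonoidHom M γ)) h' =
      (resFunctor (φ : H →* G)).map (actHom (discreteTopRep G M) γ) ≫
        resHomOfEquivariant φ ψ h := by
    apply TopRep.hom_ext
    apply ContIntertwiningMap.ext
    ext m
    rfl
  have hc := ContinuousCohomology.map_comp (conjCMH γ) φ (actHom (discreteTopRep G M) γ)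
    (resHomOfEquivariant φ ψ h) 1
  rw [map_conj_one_eq_id, Category.id_comp] at hc
  rw [e]
  exact hc

/-- Functoriality of `H¹` along compatible pairs: the pair `(φ ∘ φ', ψ' ∘ ψ)` induces the composite
of the maps induced by `(φ, ψ)` and `(φ', ψ')` (Mathlib `ContinuousCohomology.map_comp`).
Congruence form. Serre, *Galois Cohomology*, I.§2.4. [folklore] -/
theorem map_one_eq_comp_of_eq (φ : H →ₜ* G) (ψ : M →+ N)
    (h : ∀ (x : H) (m : M), ψ (φ x • m) = x • ψ m) (φ' : L →ₜ* H) (ψ' : N →+ Q)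
    (h' : ∀ (x : L) (m : N), ψ' (φ' x • m) = x • ψ' m) {Φ : L →ₜ* G} {Ψ : M →+ Q}
    (hh : ∀ (x : L) (m : M), Ψ (Φ x • m) = x • Ψ m)
    (hΦ : Φ = φ.comp φ') (hΨ : Ψ = ψ'.comp ψ) :
    ContinuousCohomology.map Φ (resHomOfEquivariant Φ Ψ hh) 1 =
      ContinuousCohomology.map φ (resHomOfEquivariant φ ψ h) 1 ≫
        ContinuousCohomology.map φ' (resHomOfEquivariant φ' ψ' h') 1 := by
  subst hΦ hΨ
  have e : resHomOfEquivariant (φ.comp φ') (ψ'.comp ψ) hh =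
      (resFunctor (φ' : L →* H)).map (resHomOfEquivariant φ ψ h) ≫
        resHomOfEquivariant φ' ψ' h' := by
    apply TopRep.hom_ext
    apply ContIntertwiningMap.ext
    ext m
    rfl
  rw [e]
  exact ContinuousCohomology.map_comp φ φ' (resHomOfEquivariant φ ψ h)
    (resHomOfEquivariant φ' ψ' h') 1

/-- The identity pair induces the identity of `H¹` (Mathlib `ContinuousCohomology.map_id`).
Congruence form. [folklore] -/
theorem map_one_eq_id_of_eq {φ : G →ₜ* G} {ψ : M →+ M}
    (h : ∀ (x : G) (m : M), ψ (φ x • m) = x • ψ m)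
    (hφ : φ = ContinuousMonoidHom.id G) (hψ : ψ = AddMonoidHom.id M) :
    ContinuousCohomology.map φ (resHomOfEquivariant φ ψ h) 1 = 𝟙 _ := by
  subst hφ hψ
  have e : resHomOfEquivariant (ContinuousMonoidHom.id G) (AddMonoidHom.id M) h =
      𝟙 (discreteTopRep G M) := by
    apply TopRep.hom_ext
    apply ContIntertwiningMap.ext
    ext m
    rfl
  rw [e]
  exact ContinuousCohomology.map_id _ 1

end Generic

variable {σ₁ σ₂ : K ≃ₐ[k] K} {τ₁ τ₂ : AlgebraicClosure K ≃+* AlgebraicClosure K}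

/-- Two lifts of the same `σ` differ by an element of `Γ_K`: `γ = τ₂⁻¹ τ₁`. [folklore] -/
def IsLiftOfAut.divGal (hτ₁ : IsLiftOfAut σ τ₁) (hτ₂ : IsLiftOfAut σ τ₂) :
    Field.absoluteGaloisGroup K :=
  show Kbar ≃ₐ[K] Kbar from
  { τ₁.trans τ₂.symm with
    commutes' := fun x ↦ by
      change τ₂.symm (τ₁ (algebraMap K _ x)) = _
      rw [hτ₁, hτ₂.symm_apply, AlgEquiv.symm_apply_apply] }

/-- Unfolding `IsLiftOfAut.divGal`: `γ x = τ₂⁻¹ (τ₁ x)`. [folklore] -/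
theorem IsLiftOfAut.divGal_apply (hτ₁ : IsLiftOfAut σ τ₁) (hτ₂ : IsLiftOfAut σ τ₂) (x : Kbar) :
    (show Kbar ≃ₐ[K] Kbar from hτ₁.divGal hτ₂) x = τ₂.symm (τ₁ x) := rfl

/-- Unfolding the inverse of `IsLiftOfAut.divGal`: `γ⁻¹ x = τ₁⁻¹ (τ₂ x)`. [folklore] -/
theorem IsLiftOfAut.divGal_symm_apply (hτ₁ : IsLiftOfAut σ τ₁) (hτ₂ : IsLiftOfAut σ τ₂)
    (x : Kbar) : (show Kbar ≃ₐ[K] Kbar from hτ₁.divGal hτ₂).symm x = τ₁.symm (τ₂ x) := rfl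

/-- Changing the lift by `γ ∈ Γ_K` conjugates the Galois side of the pair:
`τ₁⁻¹ g τ₁ = γ⁻¹ (τ₂⁻¹ g τ₂) γ`. [folklore] -/
theorem IsLiftOfAut.conjGalCMH_eq_conj_comp (hτ₁ : IsLiftOfAut σ τ₁) (hτ₂ : IsLiftOfAut σ τ₂) :
    hτ₁.conjGalCMH = (conjCMH (hτ₁.divGal hτ₂)).comp hτ₂.conjGalCMH := by
  apply ContinuousMonoidHom.ext
  intro g
  apply AlgEquiv.ext
  intro x
  change τ₁.symm ((show Kbar ≃ₐ[K] Kbar from g) (τ₁ x)) =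
    τ₁.symm (τ₂ (τ₂.symm ((show Kbar ≃ₐ[K] Kbar from g) (τ₂ (τ₂.symm (τ₁ x))))))
  rw [RingEquiv.apply_symm_apply, RingEquiv.apply_symm_apply]

/-- Changing the lift by `γ ∈ Γ_K` twists the coefficient side of the pair: `τ₁ P = τ₂ (γ P)`.
[folklore] -/
theorem IsLiftOfAut.torsionMap_eq_comp (hτ₁ : IsLiftOfAut σ τ₁) (hτ₂ : IsLiftOfAut σ τ₂) (n : ℤ) :
    hτ₁.torsionMap W n = (hτ₂.torsionMap W n).comp
      (DistribSMul.toAddMonoidHom (geomTorsion (W.baseChange K) n) (hτ₁.divGal hτ₂)) := by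
  ext P
  change hτ₁.pointsMap W P = hτ₂.pointsMap W ((hτ₁.divGal hτ₂) • (P : geomPoints (W.baseChange K)))
  generalize (P : geomPoints (W.baseChange K)) = R
  change ((W.baseChange K).baseChange Kbar).toAffine.Point at R
  rcases R with _ | ⟨x, y, h⟩
  · rfl
  · exact Affine.Point.some_eq_some_of_eq (τ₂.apply_symm_apply _).symm (τ₂.apply_symm_apply _).symm

/-- **Independence of the lift**: two lifts of `σ` induce the same automorphism of `H¹(K, E[n])`
(they differ by `γ ∈ Γ_K`, which twists the compatible pair by an inner automorphism, and inner
automorphisms act trivially on `H¹`: the tree's `map_conj_one_eq_id`).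
Serre, *Local Fields*, VII.§5, Prop. 3. [cite: SerreLocalFields1979, VII.§5 Prop. 3] -/
theorem IsLiftOfAut.conjH1_eq (hτ₁ : IsLiftOfAut σ τ₁) (hτ₂ : IsLiftOfAut σ τ₂) (n : ℤ) :
    hτ₁.conjH1 W n = hτ₂.conjH1 W n := by
  unfold IsLiftOfAut.conjH1
  rw [map_one_eq_of_conj_comp hτ₂.conjGalCMH (hτ₂.torsionMap W n) (hτ₂.torsionMap_smul W n)
    (hτ₁.divGal hτ₂) (hτ₁.torsionMap_smul W n) (hτ₁.conjGalCMH_eq_conj_comp hτ₂)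
    (hτ₁.torsionMap_eq_comp W hτ₂ n)]

/-- Lifts compose: `τ₂ ∘ τ₁` lifts `σ₂ σ₁`. [folklore] -/
theorem IsLiftOfAut.trans (hτ₁ : IsLiftOfAut σ₁ τ₁) (hτ₂ : IsLiftOfAut σ₂ τ₂) :
    IsLiftOfAut (σ₂ * σ₁) (τ₁.trans τ₂) := fun x ↦ by
  rw [RingEquiv.trans_apply, hτ₁, hτ₂, AlgEquiv.mul_apply]

/-- The Galois side of the pair of a composite lift is the composite. [folklore] -/
theorem IsLiftOfAut.conjGalCMH_trans (hτ₁ : IsLiftOfAut σ₁ τ₁) (hτ₂ : IsLiftOfAut σ₂ τ₂) :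
    (hτ₁.trans hτ₂).conjGalCMH = hτ₁.conjGalCMH.comp hτ₂.conjGalCMH := by
  apply ContinuousMonoidHom.ext
  intro g
  apply AlgEquiv.ext
  intro x
  rfl

/-- The coefficient side of the pair of a composite lift is the composite. [folklore] -/
theorem IsLiftOfAut.torsionMap_trans (hτ₁ : IsLiftOfAut σ₁ τ₁) (hτ₂ : IsLiftOfAut σ₂ τ₂) (n : ℤ) :
    (hτ₁.trans hτ₂).torsionMap W n = (hτ₂.torsionMap W n).comp (hτ₁.torsionMap W n) := by
  ext P
  change (hτ₁.trans hτ₂).pointsMap W P = hτ₂.pointsMap W (hτ₁.pointsMap W P)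
  generalize (P : geomPoints (W.baseChange K)) = R
  change ((W.baseChange K).baseChange Kbar).toAffine.Point at R
  rcases R with _ | ⟨x, y, h⟩
  · rfl
  · rfl

/-- **Multiplicativity**: the lift `τ₂ ∘ τ₁` of `σ₂ σ₁` acts on `H¹(K, E[n])` as the composite of
the actions (Mathlib `ContinuousCohomology.map_comp`). [folklore] -/
theorem IsLiftOfAut.conjH1_trans (hτ₁ : IsLiftOfAut σ₁ τ₁) (hτ₂ : IsLiftOfAut σ₂ τ₂) (n : ℤ) :
    (hτ₁.trans hτ₂).conjH1 W n = (hτ₂.conjH1 W n).comp (hτ₁.conjH1 W n) := by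
  unfold IsLiftOfAut.conjH1
  rw [map_one_eq_comp_of_eq hτ₁.conjGalCMH (hτ₁.torsionMap W n) (hτ₁.torsionMap_smul W n)
    hτ₂.conjGalCMH (hτ₂.torsionMap W n) (hτ₂.torsionMap_smul W n)
    ((hτ₁.trans hτ₂).torsionMap_smul W n) (hτ₁.conjGalCMH_trans hτ₂) (hτ₁.torsionMap_trans W hτ₂ n)]
  rfl

/-- The identity of `K̄` lifts `1 ∈ Aut(K/k)`. [folklore] -/
theorem isLiftOfAut_one_refl : IsLiftOfAut (1 : K ≃ₐ[k] K) (RingEquiv.refl (AlgebraicClosure K)) :=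
  fun _ ↦ rfl

/-- **Identity**: the trivial lift acts trivially on `H¹(K, E[n])` (Mathlib
`ContinuousCohomology.map_id`). [folklore] -/
theorem conjH1_one_refl (n : ℤ) :
    (isLiftOfAut_one_refl (k := k) (K := K)).conjH1 W n = AddMonoidHom.id _ := by
  unfold IsLiftOfAut.conjH1
  rw [map_one_eq_id_of_eq]
  · rfl
  · apply ContinuousMonoidHom.ext
    intro g
    apply AlgEquiv.ext
    intro x
    rfl
  · ext P
    change (isLiftOfAut_one_refl (k := k) (K := K)).pointsMap W P = P
    generalize (P : geomPoints (W.baseChange K)) = R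
    change ((W.baseChange K).baseChange Kbar).toAffine.Point at R
    rcases R with _ | ⟨x, y, h⟩
    · rfl
    · rfl

/-! ### The action of `Aut(K/k)` on `H¹(K, E[n])` -/

/-- **The action of `σ ∈ Aut(K/k)` on `H¹(K, E[n])`** for a Weierstrass curve `E = W` over `k`
and a field extension `K/k`: lift `σ` to an automorphism `τ` of `K̄` and send the class of a
continuous cocycle `f : Γ_K → E[n]` to that of `g ↦ τ f(τ⁻¹ g τ)`; independent of the lift
(`IsLiftOfAut.conjH1_eq_conjAct`). For `k = ℚ`, `K` imaginary quadratic and `σ` complex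
conjugation this is the action of `Gal(K/ℚ) = ⟨1, τ⟩` on `H¹(K, E_p)` of Gross 1991, §5, giving
(5.1) `H¹(K, E_p) = H¹(K, E_p)⁺ ⊕ H¹(K, E_p)⁻` for odd `p`. [cite: GrossLMS1991, §5 (5.1)] -/
def conjAct (σ : K ≃ₐ[k] K) (n : ℤ) :
    galH1Torsion (W.baseChange K) n →+ galH1Torsion (W.baseChange K) n :=
  (isLiftOfAut_liftAut σ).conjH1 W n

/-- Any lift of `σ` computes `conjAct W σ n`. [folklore] -/
theorem IsLiftOfAut.conjH1_eq_conjAct (hτ : IsLiftOfAut σ τ) (n : ℤ) :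
    hτ.conjH1 W n = conjAct W σ n :=
  hτ.conjH1_eq W _ n

/-- `Aut(K/k)` acts: `(σ₂ σ₁)_* = σ₂_* ∘ σ₁_*` on `H¹(K, E[n])`. [folklore] -/
theorem conjAct_mul (σ₁ σ₂ : K ≃ₐ[k] K) (n : ℤ) :
    conjAct W (σ₂ * σ₁) n = (conjAct W σ₂ n).comp (conjAct W σ₁ n) := by
  rw [conjAct, conjAct, conjAct,
    ← ((isLiftOfAut_liftAut σ₁).trans (isLiftOfAut_liftAut σ₂)).conjH1_eq,
    IsLiftOfAut.conjH1_trans]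

/-- The identity of `Aut(K/k)` acts trivially on `H¹(K, E[n])`. [folklore] -/
theorem conjAct_one (n : ℤ) : conjAct W (1 : K ≃ₐ[k] K) n = AddMonoidHom.id _ := by
  rw [conjAct, (isLiftOfAut_liftAut (1 : K ≃ₐ[k] K)).conjH1_eq W isLiftOfAut_one_refl n,
    conjH1_one_refl]

/-- An involution `σ` (`σ² = 1`, e.g. complex conjugation of an imaginary quadratic field) acts
as an involution of `H¹(K, E[n])` — whence, for odd `p`, the eigenspace decomposition (5.1) of
Gross 1991, §5. [folklore] -/
theorem conjAct_conjAct_of_mul_self (hσ : σ * σ = 1) (n : ℤ) (x : galH1Torsion (W.baseChange K) n) :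
    conjAct W σ n (conjAct W σ n x) = x := by
  rw [← AddMonoidHom.comp_apply, ← conjAct_mul, hσ, conjAct_one, AddMonoidHom.id_apply]

end LiftAut


/-! ## The local vanishing condition `s_v = 0` in `H¹(K_v, E[n])` -/

section TorsionLocalKer

variable {K : Type u} [Field K] (W : WeierstrassCurve K) (E : Type u) [Field E] [Algebra K E]

/-- The map on `n`-torsion points `E(K̄)[n] → E(K̄_E)[n]` induced by the chosen `K`-embedding
`K̄ → K̄_E` (`pointsMap`, restricted and corestricted to `AddSubgroup.torsionBy`; the finite-level
analogue of the tree's `primaryPointsMap`). Silverman, *AEC*, X.§4. [folklore] -/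
def torsionPointsMap (n : ℤ) :
    geomTorsion W n →+ AddSubgroup.torsionBy (localPoints W E) n :=
  ((pointsMap W E).comp (geomTorsion W n).subtype).codRestrict _ fun P ↦ by
    simp only [AddMonoidHom.coe_comp, AddSubgroup.coe_subtype, Function.comp_apply]
    rw [AddSubgroup.torsionBy, Submodule.mem_toAddSubgroup, Submodule.mem_torsionBy_iff,
      ← map_zsmul, (mem_geomTorsion_iff W n _).mp P.2, map_zero]

/-- Unfolding `torsionPointsMap` on underlying points. [folklore] -/
@[simp] theorem coe_torsionPointsMap (n : ℤ) (P : geomTorsion W n) :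
    (torsionPointsMap W E n P : localPoints W E) = pointsMap W E P := rfl

/-- Equivariance of `torsionPointsMap` along `resGal E` (from `pointsMap_smul`). [folklore] -/
theorem torsionPointsMap_smul (n : ℤ) (g : Field.absoluteGaloisGroup E) (P : geomTorsion W n) :
    torsionPointsMap W E n (resGal (K := K) E g • P) = g • torsionPointsMap W E n P :=
  Subtype.ext (pointsMap_smul W E g P)

/-- **The local kernel `ker (H¹(K, E[n]) → H¹(E, E[n]))`** at a `K`-field `E` (a completion
`K_v`): the classes `s` with `s_v = 0` *in `H¹(K_v, E[n])`* — the condition "`s_λ ≡ 0` in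
`H¹(K_λ, E_p)`" of Gross 1991, Prop. 8.2 and Prop. 9.6, and "`c_λ = 0`" of McCallum 1991, §3 (3).
It is contained in the Selmer local kernel `selmerLocalKer W E n = ker (H¹(K, E[n]) → H¹(E, E))`
(the map to `H¹(E, E)` factors through `H¹(E, E[n])`). Built like `selmerLocalKer`, with Mathlib's
`ContinuousCohomology.map` along the compatible pair `(resGal E, torsionPointsMap)`; a deliberate
dot-notation extension in Mathlib's `WeierstrassCurve` namespace, like `selmerLocalKer`.
[folklore] -/
def _root_.WeierstrassCurve.torsionLocalKer (n : ℤ) : AddSubgroup (galH1Torsion W n) :=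
  resKer (resGal (K := K) E) (torsionPointsMap W E n) (torsionPointsMap_smul W E n)

/-- `ker (H¹(K, E[n]) → H¹(E, E[n])) ≤ ker (H¹(K, E[n]) → H¹(E, E))`: the second map is the first
followed by `H¹(E, E[n]) → H¹(E, E)` (functoriality, Mathlib `ContinuousCohomology.map_comp`); cf.
the exact sequence (7.4) of Gross 1991. [folklore] -/
theorem _root_.WeierstrassCurve.torsionLocalKer_le_selmerLocalKer (n : ℤ) :
    W.torsionLocalKer E n ≤ selmerLocalKer W E n := by
  intro s hs
  change _ = 0 at hs
  change _ = 0
  have hfac := map_one_eq_comp_of_eq (resGal (K := K) E) (torsionPointsMap W E n)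
    (torsionPointsMap_smul W E n) (ContinuousMonoidHom.id _)
    (AddSubgroup.torsionBy (localPoints W E) n).subtype (fun _ _ ↦ rfl)
    (Φ := resGal (K := K) E) (Ψ := (pointsMap W E).comp (geomTorsion W n).subtype)
    (fun g P ↦ by
      simp only [AddMonoidHom.coe_comp, AddSubgroup.coe_subtype, Function.comp_apply,
        Literature.NumberTheory.EllipticCurves.AddSubgroup.torsionBy.coe_smul]
      exact pointsMap_smul W E g P) rfl rfl
  simp only [LinearMap.toAddMonoidHom_coe, ContinuousLinearMap.coe_coe] at hs ⊢
  rw [hfac, TopModuleCat.hom_comp, ContinuousLinearMap.comp_apply, hs, map_zero]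

end TorsionLocalKer

/-! ## Transport of local kernels along semilinear isomorphisms of local fields

For `E = W/ℚ`, `σ ∈ Aut(K/ℚ)` and a ring isomorphism `θ : E ≃+* E'` of `K`-fields which is
`σ`-semilinear (`θ ∘ ι_E = ι_{E'} ∘ σ`; e.g. `K_v ≃ K_{σ v}`), the action of `σ` on `H¹(K, E[n])`
carries the Selmer local kernel at `E` onto the one at `E'`. -/

section Transport

variable {K : Type u} [Field K] [CharZero K] (W : WeierstrassCurve ℚ)
variable {E E' : Type u} [Field E] [Algebra K E] [Field E'] [Algebra K E']

local notation "Kbar" => AlgebraicClosure K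

/-- `θ : E ≃+* E'` is **`σ`-semilinear** for `σ ∈ Aut(K/ℚ)`: `θ (ι_E x) = ι_{E'} (σ x)` for
`x ∈ K` (e.g. the Galois transport `σ_v : K_v → K_{σ v}` of completions, Cassels–Fröhlich, Ch. VII
§1.1). [folklore] -/
def IsSemilinearRingEquiv (σ : K ≃ₐ[ℚ] K) (θ : E ≃+* E') : Prop :=
  ∀ x : K, θ (algebraMap K E x) = algebraMap K E' (σ x)

/-- Over a field of characteristic `0`, the double base change `(W⁄K)⁄F` of `W/ℚ` is `W⁄F`
(the two structure maps `ℚ → F` agree: `Subsingleton (ℚ →+* F)`). [folklore] -/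
theorem baseChange_baseChange_eq (F : Type u) [Field F] [CharZero F] [Algebra K F] :
    (W.baseChange K).baseChange F = W.baseChange F := by
  change (W.map (algebraMap ℚ K)).map (algebraMap K F) = W.map (algebraMap ℚ F)
  rw [WeierstrassCurve.map_map]
  exact congrArg W.map (Subsingleton.elim _ _)

variable (θ : E ≃+* E')

local notation "KE" => AlgebraicClosure E
local notation "KE'" => AlgebraicClosure E'

/-- `Θ : K̄_E ≃+* K̄_{E'}` **lifts** `θ : E ≃+* E'`: `Θ ∘ ι = ι' ∘ θ`. [folklore] -/
def IsLiftOfRingEquiv (θ : E ≃+* E') (Θ : KE ≃+* KE') : Prop :=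
  ∀ e : E, Θ (algebraMap E KE e) = algebraMap E' KE' (θ e)

/-- A chosen lift of `θ : E ≃+* E'` to the algebraic closures (Mathlib
`IsAlgClosure.equivOfEquiv`). [folklore] -/
def ringEquivLift : KE ≃+* KE' :=
  IsAlgClosure.equivOfEquiv (S := E) (R := E') KE KE' θ

/-- The chosen lift `ringEquivLift θ` lifts `θ` (Mathlib `IsAlgClosure.equivOfEquiv_algebraMap`).
[folklore] -/
theorem isLiftOfRingEquiv_ringEquivLift : IsLiftOfRingEquiv θ (ringEquivLift θ) := fun e ↦
  IsAlgClosure.equivOfEquiv_algebraMap (S := E) (R := E') KE KE' θ e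

variable {θ} {Θ : AlgebraicClosure E ≃+* AlgebraicClosure E'}

/-- The inverse of a lift of `θ` restricts to `θ⁻¹` on `E'`. [folklore] -/
theorem IsLiftOfRingEquiv.symm_algebraMap (hΘ : IsLiftOfRingEquiv θ Θ) (e : E') :
    Θ.symm (algebraMap E' KE' e) = algebraMap E KE (θ.symm e) := by
  apply Θ.injective
  rw [RingEquiv.apply_symm_apply, hΘ, RingEquiv.apply_symm_apply]

/-- The inverse of a lift lifts the inverse. [folklore] -/
theorem IsLiftOfRingEquiv.symm (hΘ : IsLiftOfRingEquiv θ Θ) : IsLiftOfRingEquiv θ.symm Θ.symm :=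
  hΘ.symm_algebraMap

/-- Conjugation of `Γ_{E'}` into `Γ_E` by a lift `Θ` of `θ : E ≃+* E'`: `g ↦ Θ⁻¹ g Θ`, which is
`E`-linear. Serre, *Galois Cohomology*, I.§2.4. [folklore] -/
def IsLiftOfRingEquiv.conjGal (hΘ : IsLiftOfRingEquiv θ Θ) (g : KE' ≃ₐ[E'] KE') : KE ≃ₐ[E] KE :=
  { Θ.trans (g.toRingEquiv.trans Θ.symm) with
    commutes' := fun e ↦ by
      change Θ.symm (g (Θ (algebraMap E _ e))) = _
      rw [hΘ, AlgEquiv.commutes, hΘ.symm_algebraMap, RingEquiv.symm_apply_apply] }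

/-- Unfolding `IsLiftOfRingEquiv.conjGal`: `(Θ⁻¹ g Θ) x = Θ⁻¹ (g (Θ x))`. [folklore] -/
theorem IsLiftOfRingEquiv.conjGal_apply (hΘ : IsLiftOfRingEquiv θ Θ) (g : KE' ≃ₐ[E'] KE')
    (x : KE) : hΘ.conjGal g x = Θ.symm (g (Θ x)) := rfl

/-- `conjGal` as a monoid homomorphism `Γ_{E'} → Γ_E`. [folklore] -/
def IsLiftOfRingEquiv.conjGalHom (hΘ : IsLiftOfRingEquiv θ Θ) :
    Field.absoluteGaloisGroup E' →* Field.absoluteGaloisGroup E where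
  toFun g := hΘ.conjGal g
  map_one' := by
    apply AlgEquiv.ext
    intro x
    change Θ.symm (Θ x) = x
    exact Θ.symm_apply_apply x
  map_mul' g h := by
    apply AlgEquiv.ext
    intro x
    change Θ.symm ((show KE' ≃ₐ[E'] KE' from g) ((show KE' ≃ₐ[E'] KE' from h) (Θ x))) =
      Θ.symm ((show KE' ≃ₐ[E'] KE' from g) (Θ (Θ.symm ((show KE' ≃ₐ[E'] KE' from h) (Θ x)))))
    rw [RingEquiv.apply_symm_apply]

/-- Unfolding `IsLiftOfRingEquiv.conjGalHom`. [folklore] -/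
theorem IsLiftOfRingEquiv.conjGalHom_apply (hΘ : IsLiftOfRingEquiv θ Θ)
    (g : Field.absoluteGaloisGroup E') (x : KE) :
    (show KE ≃ₐ[E] KE from hΘ.conjGalHom g) x = Θ.symm ((show KE' ≃ₐ[E'] KE' from g) (Θ x)) := rfl

/-- Continuity of `conjGalHom` (Krull topologies; same argument as
`IsLiftOfAut.continuous_conjGalHom`). [folklore] -/
theorem IsLiftOfRingEquiv.continuous_conjGalHom (hΘ : IsLiftOfRingEquiv θ Θ) :
    Continuous hΘ.conjGalHom := by
  apply continuous_of_continuousAt_one _ (continuousAt_def.mpr _)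
  intro N hN
  rw [map_one] at hN
  obtain ⟨L', hfd, hO⟩ := (krullTopology_mem_nhds_one_iff E KE N).mp hN
  refine (krullTopology_mem_nhds_one_iff E' KE' _).mpr ?_
  let b := Module.finBasis E L'
  let S : Set KE' := Set.range fun i => Θ (b i)
  refine ⟨IntermediateField.adjoin E' S, ?_, ?_⟩
  · exact IntermediateField.finiteDimensional_adjoin fun x _ => Algebra.IsIntegral.isIntegral x
  · intro g hg
    apply hO
    simp only [SetLike.mem_coe, IntermediateField.mem_fixingSubgroup_iff] at hg ⊢
    intro y hy
    change Θ.symm ((show KE' ≃ₐ[E'] KE' from g) (Θ y)) = y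
    have key : ∀ i, (show KE' ≃ₐ[E'] KE' from g) (Θ (b i)) = Θ (b i) :=
      fun i => hg _ (IntermediateField.subset_adjoin E' S ⟨i, rfl⟩)
    have hlin := b.ext
      (f₁ := (hΘ.conjGal (show KE' ≃ₐ[E'] KE' from g)).toLinearMap ∘ₗ L'.val.toLinearMap)
      (f₂ := L'.val.toLinearMap) (fun i => by
        simp only [LinearMap.coe_comp, Function.comp_apply, AlgEquiv.toLinearMap_apply,
          hΘ.conjGal_apply]
        change Θ.symm ((show KE' ≃ₐ[E'] KE' from g) (Θ (b i))) = (b i : KE)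
        rw [key, RingEquiv.symm_apply_apply])
    exact congr($hlin ⟨y, hy⟩)

/-- `conjGalHom` as a continuous monoid homomorphism `Γ_{E'} →ₜ* Γ_E`. [folklore] -/
def IsLiftOfRingEquiv.conjGalCMH (hΘ : IsLiftOfRingEquiv θ Θ) :
    Field.absoluteGaloisGroup E' →ₜ* Field.absoluteGaloisGroup E where
  toMonoidHom := hΘ.conjGalHom
  continuous_toFun := hΘ.continuous_conjGalHom

variable [CharZero E] [CharZero E'] (Θ)

/-- A ring isomorphism `Θ : K̄_E ≃+* K̄_{E'}` on local points `E(K̄_E) → E(K̄_{E'})` of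
`E = W/ℚ`: coordinates moved by the `ℚ`-algebra map `Θ` (Mathlib `Affine.Point.map` on `W⁄K̄_E`),
transported across `(W⁄K)⁄K̄_E = W⁄K̄_E` by the tree's `Affine.Point.congrEquiv`. [folklore] -/
def localPointsMap : localPoints (W.baseChange K) E →+ localPoints (W.baseChange K) E' :=
  (WeierstrassCurve.Affine.Point.congrEquiv
      (baseChange_baseChange_eq W (K := K) KE')).symm.toAddMonoidHom.comp
    ((WeierstrassCurve.Affine.Point.map (W' := W) (Θ.toRingHom.toRatAlgHom : KE →ₐ[ℚ] KE')).comp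
      (WeierstrassCurve.Affine.Point.congrEquiv
        (baseChange_baseChange_eq W (K := K) KE)).toAddMonoidHom)

/-- `localPointsMap` sends `O` to `O`. [folklore] -/
theorem localPointsMap_zero : localPointsMap W Θ (0 : localPoints (W.baseChange K) E) = 0 :=
  map_zero _

/-- `Θ` preserves nonsingularity of affine points of `(W⁄K)⁄K̄_E` (via `(W⁄K)⁄K̄_E = W⁄K̄_E` and
Mathlib `Affine.baseChange_nonsingular`). [folklore] -/
theorem nonsingular_ringEquiv {x y : KE}
    (h : ((W.baseChange K).baseChange KE).toAffine.Nonsingular x y) :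
    ((W.baseChange K).baseChange KE').toAffine.Nonsingular (Θ x) (Θ y) := by
  have h1 := (baseChange_baseChange_eq W (K := K) KE) ▸ h
  have h2 := (WeierstrassCurve.Affine.baseChange_nonsingular (W := W.toAffine) (A := KE) (B := KE')
    (S := ℚ) (f := (Θ.toRingHom.toRatAlgHom : KE →ₐ[ℚ] KE')) (RingHom.injective _) x y).mpr h1
  exact (baseChange_baseChange_eq W (K := K) KE').symm ▸ h2

/-- `localPointsMap` is `Θ` on coordinates. [folklore] -/
theorem localPointsMap_some (x y : KE)
    (h : ((W.baseChange K).baseChange KE).toAffine.Nonsingular x y) :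
    localPointsMap W Θ (show localPoints (W.baseChange K) E from .some x y h) =
      (show localPoints (W.baseChange K) E' from
        .some (Θ x) (Θ y) (nonsingular_ringEquiv W Θ h)) := by
  change (WeierstrassCurve.Affine.Point.congrEquiv _).symm
    (WeierstrassCurve.Affine.Point.map _ (WeierstrassCurve.Affine.Point.congrEquiv _ _)) = _
  rw [WeierstrassCurve.Affine.Point.congrEquiv_some, WeierstrassCurve.Affine.Point.map_some,
    AddEquiv.symm_apply_eq, WeierstrassCurve.Affine.Point.congrEquiv_some]
  rfl

/-- `Θ` followed by `Θ⁻¹` on points is the identity. [folklore] -/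
theorem localPointsMap_symm_apply (P : localPoints (W.baseChange K) E) :
    localPointsMap W Θ.symm (localPointsMap W Θ P) = P := by
  change ((W.baseChange K).baseChange KE).toAffine.Point at P
  rcases P with _ | ⟨x, y, h⟩
  · exact (congrArg _ (localPointsMap_zero W Θ)).trans (localPointsMap_zero W Θ.symm)
  · rw [localPointsMap_some W Θ x y h, localPointsMap_some W Θ.symm]
    exact Affine.Point.some_eq_some_of_eq (Θ.symm_apply_apply x) (Θ.symm_apply_apply y)

variable {Θ}

/-- Compatibility of the pair `(conjGalCMH, localPointsMap)`: `Θ (Θ⁻¹ g Θ • P) = g • Θ P`.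
Serre, *Galois Cohomology*, I.§2.4. [folklore] -/
theorem IsLiftOfRingEquiv.localPointsMap_smul (hΘ : IsLiftOfRingEquiv θ Θ)
    (g : Field.absoluteGaloisGroup E') (P : localPoints (W.baseChange K) E) :
    localPointsMap W Θ (hΘ.conjGalCMH g • P) = g • localPointsMap W Θ P := by
  change ((W.baseChange K).baseChange KE).toAffine.Point at P
  rcases P with _ | ⟨x, y, h⟩
  · change localPointsMap W Θ (hΘ.conjGalCMH g • (0 : localPoints (W.baseChange K) E)) =
      g • localPointsMap W Θ (0 : localPoints (W.baseChange K) E)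
    rw [smul_zero, localPointsMap_zero, smul_zero]
  · rw [localPoints.smul_def, localPoints.smul_def]
    change localPointsMap W Θ (WeierstrassCurve.Affine.Point.map _ (.some x y h)) =
      WeierstrassCurve.Affine.Point.map _ (localPointsMap W Θ (.some x y h))
    rw [WeierstrassCurve.Affine.Point.map_some, localPointsMap_some, localPointsMap_some,
      WeierstrassCurve.Affine.Point.map_some]
    exact Affine.Point.some_eq_some_of_eq (Θ.apply_symm_apply _) (Θ.apply_symm_apply _)

omit [CharZero E] [CharZero E'] in
/-- The two conjugations `Θ⁻¹(-)Θ` and `Θ(-)Θ⁻¹` are inverse to each other. [folklore] -/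
theorem IsLiftOfRingEquiv.conjGalCMH_comp_symm (hΘ : IsLiftOfRingEquiv θ Θ) :
    hΘ.conjGalCMH.comp hΘ.symm.conjGalCMH = ContinuousMonoidHom.id _ := by
  apply ContinuousMonoidHom.ext
  intro g
  apply AlgEquiv.ext
  intro x
  change Θ.symm (Θ.symm.symm ((show KE ≃ₐ[E] KE from g) (Θ.symm (Θ x)))) =
    (show KE ≃ₐ[E] KE from g) x
  rw [RingEquiv.symm_symm, RingEquiv.symm_apply_apply, RingEquiv.symm_apply_apply]

/-- `localPointsMap Θ⁻¹ ∘ localPointsMap Θ = id`. [folklore] -/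
theorem localPointsMap_symm_comp :
    (localPointsMap W Θ.symm :
        localPoints (W.baseChange K) E' →+ localPoints (W.baseChange K) E).comp
      (localPointsMap W Θ) = AddMonoidHom.id _ :=
  AddMonoidHom.ext (localPointsMap_symm_apply W Θ)

open CategoryTheory in
/-- The map `H¹(E, E(K̄_E)) → H¹(E', E(K̄_{E'}))` induced by a lift `Θ` is injective (the map
induced by `Θ⁻¹` is a left inverse, by `ContinuousCohomology.map_comp` and `map_id`). [folklore] -/
theorem IsLiftOfRingEquiv.map_injective (hΘ : IsLiftOfRingEquiv θ Θ) :
    Function.Injective (ContinuousCohomology.map hΘ.conjGalCMH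
      (resHomOfEquivariant hΘ.conjGalCMH (localPointsMap (K := K) W Θ)
        (hΘ.localPointsMap_smul W)) 1) := by
  have hΘ' : IsLiftOfRingEquiv θ.symm Θ.symm := hΘ.symm
  let ψ' : localPoints (W.baseChange K) E' →+ localPoints (W.baseChange K) E :=
    localPointsMap W Θ.symm
  have hψ' : ∀ (g : Field.absoluteGaloisGroup E) (P : localPoints (W.baseChange K) E'),
      ψ' (hΘ'.conjGalCMH g • P) = g • ψ' P := hΘ'.localPointsMap_smul W
  have hcomp := map_one_eq_comp_of_eq hΘ.conjGalCMH (localPointsMap W Θ) (hΘ.localPointsMap_smul W)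
    hΘ'.conjGalCMH ψ' hψ'
    (Φ := ContinuousMonoidHom.id _) (Ψ := AddMonoidHom.id _) (fun _ _ ↦ rfl)
    hΘ.conjGalCMH_comp_symm.symm (localPointsMap_symm_comp W (Θ := Θ)).symm
  rw [map_one_eq_id_of_eq (fun _ _ ↦ rfl) rfl rfl] at hcomp
  intro a b hab
  have ha := congr($hcomp a)
  have hb := congr($hcomp b)
  simp only [ConcreteCategory.id_apply, ConcreteCategory.comp_apply] at ha hb
  rw [ha, hab, ← hb]

variable {σ : K ≃ₐ[ℚ] K} {τ : AlgebraicClosure K ≃+* AlgebraicClosure K}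

/-- The `K`-embedding `ι' : K̄ → K̄_{E'}`, `x ↦ Θ (ι_E (τ⁻¹ x))`, built from a lift `τ` of `σ`,
the chosen embedding `ι_E : K̄ → K̄_E` and a lift `Θ` of the `σ`-semilinear `θ : E ≃+* E'`; it is
`K`-linear because the two `σ`-twists cancel. By the independence of the embedding (tree
`selmerLocalKer_eq_of_algHom_holds`, Serre, *Galois Cohomology*, II.§1.1) it may be used to
compute the local kernel at `E'`. [folklore] -/
def embOfLifts (hτ : IsLiftOfAut σ τ) (hθ : IsSemilinearRingEquiv σ θ)
    (hΘ : IsLiftOfRingEquiv θ Θ) :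
    AlgebraicClosure K →ₐ[K] AlgebraicClosure E' :=
  { (Θ.toRingHom.comp (closureEmb (K := K) E).toRingHom).comp τ.symm.toRingHom with
    commutes' := fun x ↦ by
      change Θ (closureEmb (K := K) E (τ.symm (algebraMap K Kbar x))) = algebraMap K KE' x
      rw [hτ.symm_apply, AlgHom.commutes, IsScalarTower.algebraMap_apply K E KE, hΘ, hθ,
        AlgEquiv.apply_symm_apply, ← IsScalarTower.algebraMap_apply] }

omit [CharZero E] [CharZero E'] in
/-- Unfolding `embOfLifts`: `ι' x = Θ (ι_E (τ⁻¹ x))`. [folklore] -/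
theorem embOfLifts_apply (hτ : IsLiftOfAut σ τ) (hθ : IsSemilinearRingEquiv σ θ)
    (hΘ : IsLiftOfRingEquiv θ Θ) (x : AlgebraicClosure K) :
    embOfLifts hτ hθ hΘ x = Θ (closureEmb (K := K) E (τ.symm x)) := rfl

omit [CharZero E] [CharZero E'] in
/-- The Galois sides of the two composite pairs agree:
`τ⁻¹ (res_{ι'} g) τ = res_{ι_E} (Θ⁻¹ g Θ)` for `ι' = Θ ι_E τ⁻¹` (both are `g ↦ j⁻¹ g j` for
`j = Θ ι_E`). [folklore] -/
theorem conjGalCMH_comp_resGalOfEmb_embOfLifts (hτ : IsLiftOfAut σ τ)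
    (hθ : IsSemilinearRingEquiv σ θ) (hΘ : IsLiftOfRingEquiv θ Θ) :
    hτ.conjGalCMH.comp (resGalOfEmb (embOfLifts hτ hθ hΘ)) =
      (resGal (K := K) E).comp hΘ.conjGalCMH := by
  apply ContinuousMonoidHom.ext
  intro g
  apply AlgEquiv.ext
  intro x
  apply (Θ.toRingHom.comp (closureEmb (K := K) E).toRingHom).injective
  change Θ (closureEmb (K := K) E (τ.symm ((show Kbar ≃ₐ[K] Kbar from
      resGalAuxOfEmb (embOfLifts hτ hθ hΘ) g) (τ x)))) =
    Θ (closureEmb (K := K) E ((show Kbar ≃ₐ[K] Kbar from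
      resGalAuxOfEmb (closureEmb (K := K) E) (hΘ.conjGalCMH g)) x))
  rw [← embOfLifts_apply hτ hθ hΘ, apply_resGalAuxOfEmb_apply, apply_resGalAuxOfEmb_apply,
    embOfLifts_apply]
  change _ = Θ (Θ.symm ((show KE' ≃ₐ[E'] KE' from g) (Θ (closureEmb (K := K) E x))))
  rw [RingEquiv.apply_symm_apply, RingEquiv.symm_apply_apply]

/-- The coefficient sides of the two composite pairs agree: `ι' (τ P) = Θ (ι_E P)` on `E[n]`.
[folklore] -/
theorem pointsMapOfEmb_embOfLifts_comp_torsionMap (hτ : IsLiftOfAut σ τ)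
    (hθ : IsSemilinearRingEquiv σ θ) (hΘ : IsLiftOfRingEquiv θ Θ) (n : ℤ) :
    ((pointsMapOfEmb (W.baseChange K) (embOfLifts hτ hθ hΘ)).comp
        (geomTorsion (W.baseChange K) n).subtype).comp (hτ.torsionMap W n) =
      (localPointsMap W Θ).comp ((pointsMap (W.baseChange K) E).comp
        (geomTorsion (W.baseChange K) n).subtype) := by
  ext P
  change pointsMapOfEmb (W.baseChange K) (embOfLifts hτ hθ hΘ) (hτ.pointsMap W P) =
    localPointsMap W Θ (pointsMap (W.baseChange K) E P)
  generalize (P : geomPoints (W.baseChange K)) = R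
  change ((W.baseChange K).baseChange Kbar).toAffine.Point at R
  rcases R with _ | ⟨x, y, h⟩
  · exact (localPointsMap_zero W Θ).symm
  · change _ = localPointsMap W Θ (WeierstrassCurve.Affine.Point.map (W' := W.baseChange K)
      (closureEmb (K := K) E) (.some x y h))
    rw [WeierstrassCurve.Affine.Point.map_some, localPointsMap_some]
    exact Affine.Point.some_eq_some_of_eq
      (show Θ (closureEmb (K := K) E (τ.symm (τ x))) = _ by rw [RingEquiv.symm_apply_apply])
      (show Θ (closureEmb (K := K) E (τ.symm (τ y))) = _ by rw [RingEquiv.symm_apply_apply])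

/-- Congruence: equal compatible pairs induce equal maps on `H¹`. [folklore] -/
theorem map_one_pair_congr {G : Type u} [Group G] [TopologicalSpace G] [IsTopologicalGroup G]
    {M : Type u} [AddCommGroup M] [DistribMulAction G M] [TopologicalSpace M] [DiscreteTopology M]
    {H : Type u} [Group H] [TopologicalSpace H] [IsTopologicalGroup H]
    {N : Type u} [AddCommGroup N] [DistribMulAction H N] [TopologicalSpace N] [DiscreteTopology N]
    {φ φ' : H →ₜ* G} {ψ ψ' : M →+ N} (hφ : φ = φ') (hψ : ψ = ψ')
    (h : ∀ (x : H) (m : M), ψ (φ x • m) = x • ψ m)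
    (h' : ∀ (x : H) (m : M), ψ' (φ' x • m) = x • ψ' m) :
    ContinuousCohomology.map φ (resHomOfEquivariant φ ψ h) 1 =
      ContinuousCohomology.map φ' (resHomOfEquivariant φ' ψ' h') 1 := by
  subst hφ hψ
  rfl

open CategoryTheory in
/-- **Transport of the Selmer local kernel along a `σ`-semilinear isomorphism.** For `E = W/ℚ`,
`σ ∈ Aut(K/ℚ)` and a `σ`-semilinear ring isomorphism `θ : E ≃+* E'` of `K`-fields
(`θ ∘ ι_E = ι_{E'} ∘ σ`), a class `s ∈ H¹(K, E[n])` dies in `H¹(E, E(K̄_E))` iff `σ_* s` dies in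
`H¹(E', E(K̄_{E'}))`: with the embedding `ι' = Θ ι_E τ⁻¹` at `E'` (allowed by
`selmerLocalKer_eq_of_algHom_holds`) the composite pair computing `(σ_* s)|_{E'}` *is* the pair
computing `s|_E` followed by the isomorphism of pairs induced by `Θ`, whose `H¹`-map is injective.
This is the mechanism behind "`Gal(K/ℚ)` acts on `Sel(E/K)_p`" (Gross 1991, §§5, 8) and behind
Cassels–Fröhlich, Ch. VII §1.1. [folklore] -/
theorem conjAct_mem_selmerLocalKer_iff (σ : K ≃ₐ[ℚ] K) (θ : E ≃+* E')
    (hθ : IsSemilinearRingEquiv σ θ) (n : ℤ) (s : galH1Torsion (W.baseChange K) n) :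
    conjAct W σ n s ∈ selmerLocalKer (W.baseChange K) E' n ↔
      s ∈ selmerLocalKer (W.baseChange K) E n := by
  have hτ : IsLiftOfAut σ (liftAut σ) := isLiftOfAut_liftAut σ
  have hΘ : IsLiftOfRingEquiv θ (ringEquivLift θ) := isLiftOfRingEquiv_ringEquivLift θ
  set ι' := embOfLifts hτ hθ hΘ with hι'
  rw [← selmerLocalKer_eq_of_algHom_holds (W.baseChange K) E' ι' n]
  -- the two composite pairs and their `H¹` maps
  have hA := map_one_eq_comp_of_eq hτ.conjGalCMH (hτ.torsionMap W n) (hτ.torsionMap_smul W n)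
    (resGalOfEmb ι')
    ((pointsMapOfEmb (W.baseChange K) ι').comp (geomTorsion (W.baseChange K) n).subtype)
    (fun g P ↦ by
      simp only [AddMonoidHom.coe_comp, AddSubgroup.coe_subtype, Function.comp_apply,
        Literature.NumberTheory.EllipticCurves.AddSubgroup.torsionBy.coe_smul]
      exact pointsMapOfEmb_smul _ ι' g _)
    (Φ := hτ.conjGalCMH.comp (resGalOfEmb ι'))
    (Ψ := ((pointsMapOfEmb (W.baseChange K) ι').comp (geomTorsion (W.baseChange K) n).subtype).comp
      (hτ.torsionMap W n))
    (fun g P ↦ by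
      simp only [AddMonoidHom.coe_comp, AddSubgroup.coe_subtype, Function.comp_apply,
        ContinuousMonoidHom.comp_toFun]
      rw [hτ.torsionMap_smul W n]
      simp only [Literature.NumberTheory.EllipticCurves.AddSubgroup.torsionBy.coe_smul]
      exact pointsMapOfEmb_smul _ ι' g _) rfl rfl
  have hB := map_one_eq_comp_of_eq (resGal (K := K) E)
    ((pointsMap (W.baseChange K) E).comp (geomTorsion (W.baseChange K) n).subtype)
    (fun g P ↦ by
      simp only [AddMonoidHom.coe_comp, AddSubgroup.coe_subtype, Function.comp_apply,
        Literature.NumberTheory.EllipticCurves.AddSubgroup.torsionBy.coe_smul]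
      exact pointsMap_smul _ E g _)
    hΘ.conjGalCMH (localPointsMap W (ringEquivLift θ)) (hΘ.localPointsMap_smul W)
    (Φ := (resGal (K := K) E).comp hΘ.conjGalCMH)
    (Ψ := (localPointsMap W (ringEquivLift θ)).comp ((pointsMap (W.baseChange K) E).comp
      (geomTorsion (W.baseChange K) n).subtype))
    (fun g P ↦ by
      simp only [AddMonoidHom.coe_comp, AddSubgroup.coe_subtype, Function.comp_apply,
        ContinuousMonoidHom.comp_toFun]
      rw [← hΘ.localPointsMap_smul W]
      congr 1
      exact pointsMap_smul _ E _ _) rfl rfl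
  have hAB := map_one_pair_congr (conjGalCMH_comp_resGalOfEmb_embOfLifts hτ hθ hΘ)
    (pointsMapOfEmb_embOfLifts_comp_torsionMap W hτ hθ hΘ n)
    (fun g P ↦ by
      simp only [AddMonoidHom.coe_comp, AddSubgroup.coe_subtype, Function.comp_apply,
        ContinuousMonoidHom.comp_toFun]
      rw [hτ.torsionMap_smul W n]
      simp only [Literature.NumberTheory.EllipticCurves.AddSubgroup.torsionBy.coe_smul]
      exact pointsMapOfEmb_smul _ ι' g _)
    (fun g P ↦ by
      simp only [AddMonoidHom.coe_comp, AddSubgroup.coe_subtype, Function.comp_apply,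
        ContinuousMonoidHom.comp_toFun]
      rw [← hΘ.localPointsMap_smul W]
      congr 1
      exact pointsMap_smul _ E _ _)
  rw [hA, hB] at hAB
  -- conclude
  rw [selmerLocalKerOfEmb, mem_resKer_iff, selmerLocalKer, mem_resKer_iff,
    ← hτ.conjH1_eq_conjAct W n, IsLiftOfAut.conjH1]
  simp only [LinearMap.toAddMonoidHom_coe, ContinuousLinearMap.coe_coe]
  rw [← ConcreteCategory.comp_apply, hAB, ConcreteCategory.comp_apply]
  constructor
  · intro h
    apply IsLiftOfRingEquiv.map_injective W hΘ
    rw [h, map_zero]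
  · intro h
    rw [h, map_zero]

end Transport

/-! ## Local kernels at algebraically closed completions are everything -/

section AlgClosed

variable {K : Type u} [Field K] (W : WeierstrassCurve K) (E : Type u) [Field E] [Algebra K E]

/-- The absolute Galois group of an algebraically closed field is trivial. [folklore] -/
theorem subsingleton_absoluteGaloisGroup_of_isAlgClosed [IsAlgClosed E] :
    Subsingleton (Field.absoluteGaloisGroup E) := by
  refine ⟨fun g h ↦ ?_⟩
  apply AlgEquiv.ext
  intro x
  obtain ⟨e, rfl⟩ := (IsAlgClosed.algebraMap_bijective_of_isIntegral (k := E)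
    (K := AlgebraicClosure E)).2 x
  rw [AlgEquiv.commutes, AlgEquiv.commutes]

/-- Over a `K`-field `E` with trivial absolute Galois group (e.g. `E` algebraically closed: a
complex place), every class of `H¹(K, E[n])` dies in `H¹(E, E(K̄_E))`: the Selmer local condition
at `E` is empty (Gross 1991, proof of Prop. 6.2 (1): "If `v = ∞`, `K_v = ℂ` is algebraically
closed and the Galois cohomology of `E` is trivial"). A deliberate dot-notation extension in
Mathlib's `WeierstrassCurve` namespace. [cite: GrossLMS1991, §6 (proof of Prop. 6.2 (1))] -/
theorem _root_.WeierstrassCurve.selmerLocalKer_eq_top_of_subsingleton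
    [Subsingleton (Field.absoluteGaloisGroup E)] (n : ℤ) : selmerLocalKer W E n = ⊤ := by
  rw [eq_top_iff]
  intro c _
  obtain ⟨f, rfl⟩ := GaloisRepresentations.oneCocycleClass_surjective _ c
  rw [selmerLocalKer, oneCocycleClass_mem_resKer_iff]
  refine ⟨0, fun x ↦ ?_⟩
  rw [Subsingleton.elim x 1, map_one, GaloisRepresentations.contOneCocycles.apply_one, map_zero,
    smul_zero, sub_zero]

/-- `selmerLocalKer = ⊤` at an algebraically closed `K`-field. [folklore] -/
theorem _root_.WeierstrassCurve.selmerLocalKer_eq_top_of_isAlgClosed [IsAlgClosed E] (n : ℤ) :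
    selmerLocalKer W E n = ⊤ :=
  haveI := subsingleton_absoluteGaloisGroup_of_isAlgClosed E
  W.selmerLocalKer_eq_top_of_subsingleton E n

/-- Algebraic closedness transfers along ring isomorphisms (universe-polymorphic form of Mathlib's
`IsAlgClosed.of_ringEquiv`). [folklore] -/
theorem isAlgClosed_of_ringEquiv {k : Type*} {k' : Type*} [Field k] [Field k'] (e : k ≃+* k')
    [IsAlgClosed k] : IsAlgClosed k' := by
  apply IsAlgClosed.of_exists_root
  intro p hmp hp
  have hpe : (p.map e.symm.toRingHom).degree ≠ 0 := by
    rw [Polynomial.degree_map]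
    exact ne_of_gt (Polynomial.degree_pos_of_irreducible hp)
  obtain ⟨x, hx⟩ := IsAlgClosed.exists_root (p.map e.symm.toRingHom) hpe
  refine ⟨e x, ?_⟩
  rw [Polynomial.IsRoot, Polynomial.eval_map, show x = e.symm.toRingHom (e x) from
    (e.symm_apply_apply x).symm, Polynomial.eval₂_hom] at hx
  exact (map_eq_zero_iff _ e.symm.injective).mp hx

end AlgClosed

/-! ## Stability of the Selmer group under `Aut(K/ℚ)` -/

section Stability

open NumberField IsDedekindDomain Literature.NumberTheory.Automorphic

variable {K : Type u} [Field K] [NumberField K] (W : WeierstrassCurve ℚ)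

/-- The Galois transport `K_v ≃+* K_{σ v}` of completions (tree `galAdicCompletionEquiv`, file
`Automorphic/GaloisActionPlaces`; Cassels–Fröhlich, Ch. VII §1.1) is `σ`-semilinear.
[cite: CasselsFrohlichANT1967, Ch. VII §1.1] -/
theorem isSemilinearRingEquiv_galAdicCompletionEquiv (σ : K ≃ₐ[ℚ] K)
    {v v' : HeightOneSpectrum (𝓞 K)} (h : σ • v = v') :
    IsSemilinearRingEquiv σ (galAdicCompletionEquiv (L := K) σ h) := fun x ↦ by
  change galAdicCompletionMap σ h (x : v.adicCompletion K) = ((σ x : K) : v'.adicCompletion K)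
  exact galAdicCompletionMap_coe_algEquiv ℚ σ h x

/-- **The Selmer group `Sel^(n)(E/K)` of `E = W/ℚ` is stable under `Aut(K/ℚ)`** for a number field
`K` all of whose infinite places are complex (e.g. imaginary quadratic): `σ_*` carries the local
condition at `σ⁻¹ v` to the one at `v` (`conjAct_mem_selmerLocalKer_iff` with the Galois transport
of completions `galAdicCompletionEquiv`), and the conditions at the complex places are empty
(`selmerLocalKer_eq_top_of_isAlgClosed`). This is the `Gal(K/ℚ)`-module structure of `Sel(E/K)_p`
used throughout Gross 1991, §§5–10 (Prop. 8.2: "the subgroup `Sel(E/K)_p^± ⊂ H¹(K, E_p)^±`";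
§10: "treating the eigenspaces of `Sel(E/K)_p` in turn"). [cite: GrossLMS1991, §5 (5.1) and §10] -/
theorem conjAct_mem_selmerGroup (hK : ∀ w : InfinitePlace K, w.IsComplex) (σ : K ≃ₐ[ℚ] K) (n : ℤ)
    {s : galH1Torsion (W.baseChange K) n} (hs : s ∈ selmerGroup (W.baseChange K) n) :
    conjAct W σ n s ∈ selmerGroup (W.baseChange K) n := by
  rw [mem_selmerGroup_iff] at hs ⊢
  refine ⟨fun v' ↦ ?_, fun w ↦ ?_⟩
  · have h : σ • (σ⁻¹ • v') = v' := smul_inv_smul σ v'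
    haveI : CharZero ((σ⁻¹ • v').adicCompletion K) :=
      charZero_of_injective_algebraMap (algebraMap K _).injective
    haveI : CharZero (v'.adicCompletion K) :=
      charZero_of_injective_algebraMap (algebraMap K _).injective
    exact (conjAct_mem_selmerLocalKer_iff W σ (galAdicCompletionEquiv (L := K) σ h)
      (isSemilinearRingEquiv_galAdicCompletionEquiv σ h) n s).mpr (hs.1 _)
  · haveI : IsAlgClosed w.Completion :=
      isAlgClosed_of_ringEquiv (InfinitePlace.Completion.ringEquivComplexOfIsComplex (hK w)).symm
    rw [WeierstrassCurve.selmerLocalKer_eq_top_of_isAlgClosed]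
    trivial

end Stability

end Literature.NumberTheory.EllipticCurves
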